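import Mathlib
import HarnessLib
import Summits.Ventures.LatticeQCDFlow.Exactness.SphereFlowSamplerVolumeLaw
import Summits.Ventures.LatticeQCDFlow.Exactness.SphereIndependenceSamplerAcceptance

/-!
# The acceptance law of exact flow samplers on the lattice of spheres: bounded differences `D_k` of the effective action give mean Metropolis acceptance `≥ exp(−(ΣD_k²/8 + √(ΣD_k²/8)))` — every jointly `C³` generator

HONEST FRAMING: exact (Metropolis-corrected) sampling algorithms for lattice gauge theory;
figures of merit are autocorrelation/cost numbers at stated couplings and volumes; no
continuum-physics claim.

Venture `LatticeQCDFlow` (cell pub-lqcd), topic `Exactness`; FANOUT row 7 (`s0-cpn-null`).  NEW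
WORK of the cell over this leg's `Exactness/SphereFlowSamplerVolumeLaw.lean` (bounded differences of
`S_eff = t·S∘Φ_{s→c} − ℓ_{s→c}` ⇒ `Var ≤ ΣD_k²/4`, `∫e^{u(S_eff − E S_eff)} ≤ e^{u²ΣD_k²/8}`) and
`Exactness/SphereIndependenceSamplerAcceptance.lean` (the acceptance floor `exp(−(a + √(v/2)))` from
an exponential-moment bound `a` and a variance bound `v` of the log-weight); nothing is cited as a
fact.  Printed counterpart, NAMED ONLY: the flow-based independence Metropolis sampler of
Albergo–Kanwar–Shanahan, Phys. Rev. D 100 (2019) 034515, §II.  The leg's LO instance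
(`SphereLOFlowAcceptance`: `acc ≥ exp(−(|Λ|D²/8 + D√(|Λ|/8)))`) is the case `D_k = D` for all `k`.

## Content

* **`exp_neg_le_meanAccept_of_bddDiff`** — for every jointly `C³` generator `G`, `S ∈ C¹`, real
  `t`, times `s, c`, and bounded differences `D_k` of `S_eff` on `Ω`: the mean Metropolis acceptance of
  the independence sampler (target `π̄.tilted(−S_eff)`, whose `Φ_{s→c}`-image is `π̄.tilted(−tS)`;
  proposal `π̄`) obeys `acc ≥ exp(−(ΣD_k²/8 + √(ΣD_k²/8)))`;
  **`one_sub_le_meanAccept_of_bddDiff`** — `acc ≥ 1 − ΣD_k²/8 − √(ΣD_k²/8)`: per-site differences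
  `O(δ)` uniformly in the volume give an acceptance deficit `O(δ√|Λ| + δ²|Λ|)`.

NOT CLAIMED: upper bounds on the acceptance (the acceptance–footprint law is separate);
autocorrelations; how to get `D_k` for a given generator; numbers.
-/

noncomputable section

namespace Summit.Ventures.LatticeQCDFlow.Exactness

open Function Set Metric MeasureTheory NormedSpace InnerProductSpace
open scoped RealInnerProductSpace Topology

variable {Λ : Type*} {E : Type*} [NormedAddCommGroup E] [InnerProductSpace ℝ E]
  [FiniteDimensional ℝ E] [Fintype Λ] [DecidableEq Λ] [MeasurableSpace E] [BorelSpace E] [Nontrivial E]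
  {G : ℝ → (Λ → E) → ℝ} {T : ℝ}

/-- **THE ACCEPTANCE LAW OF EXACT FLOW SAMPLERS.**  For a jointly `C³` generator, `S ∈ C¹`, real `t`
and times `s, c`: if the effective action `S_eff = t·S∘Φ_{s→c} − ℓ_{s→c}` has bounded differences
`D_k` on `Ω`, the mean Metropolis acceptance of the independence sampler with target
`π̄.tilted(−S_eff)` and proposal `π̄` is at least `exp(−(ΣD_k²/8 + √(ΣD_k²/8)))`. -/
theorem exp_neg_le_meanAccept_of_bddDiff (hG : ContDiff ℝ 2 fun q : ℝ × (Λ → E) => G q.1 q.2)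
    (hG3 : ContDiff ℝ 3 fun q : ℝ × (Λ → E) => G q.1 q.2) {S : (Λ → E) → ℝ} (hS : ContDiff ℝ 1 S)
    (t s c : ℝ) {D : Λ → ℝ}
    (hD : ∀ (ω : Λ → sphere (0 : E) 1) (k : Λ) (v v' : sphere (0 : E) 1),
      (t * S (sphereTDFlow hG T s c (fun m => ((update ω k v) m : E))) -
          sphereTDFlowLogJac hG T s c (fun m => ((update ω k v) m : E))) -
        (t * S (sphereTDFlow hG T s c (fun m => ((update ω k v') m : E))) -
          sphereTDFlowLogJac hG T s c (fun m => ((update ω k v') m : E))) ≤ D k) :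
    Real.exp (-((∑ k, D k ^ 2) / 8 + Real.sqrt ((∑ k, D k ^ 2) / 8))) ≤
      ∫ ω, (∫ ω', min 1 (Real.exp
          ((t * S (sphereTDFlow hG T s c (fun m => ((ω : Λ → sphere (0 : E) 1) m : E))) -
              sphereTDFlowLogJac hG T s c (fun m => (ω m : E))) -
            (t * S (sphereTDFlow hG T s c (fun m => ((ω' : Λ → sphere (0 : E) 1) m : E))) -
              sphereTDFlowLogJac hG T s c (fun m => (ω' m : E)))))
          ∂Measure.pi (fun _ : Λ => uniformSphere (volume : Measure E)))
        ∂(Measure.pi (fun _ : Λ => uniformSphere (volume : Measure E))).tilted (fun ω =>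
          -(t * S (sphereTDFlow hG T s c (fun m => (ω m : E))) -
              sphereTDFlowLogJac hG T s c (fun m => (ω m : E)))) := by
  have hmgf := integral_exp_mul_effAction_sub_le_of_bddDiff hG hG3 hS t s c hD (-1) (T := T)
  have hvar := variance_effAction_le_of_bddDiff hG hG3 hS t s c hD (T := T)
  set A : ℝ := ∑ k, D k ^ 2 with hA
  have ha : (-1 : ℝ) ^ 2 * A / 8 = A / 8 := by ring
  simp only [neg_one_mul] at hmgf
  rw [ha] at hmgf
  have h := exp_neg_le_meanAccept_of_mgf_of_variance (continuous_effAction hG hG3 hS t s c (T := T))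
    hmgf hvar
  have hsqrt : Real.sqrt (A / 4 / 2) = Real.sqrt (A / 8) := by
    congr 1; ring
  rw [hsqrt] at h
  exact h

/-- **Corollary**: `acc ≥ 1 − ΣD_k²/8 − √(ΣD_k²/8)` (`e^{−x} ≥ 1 − x`). -/
theorem one_sub_le_meanAccept_of_bddDiff (hG : ContDiff ℝ 2 fun q : ℝ × (Λ → E) => G q.1 q.2)
    (hG3 : ContDiff ℝ 3 fun q : ℝ × (Λ → E) => G q.1 q.2) {S : (Λ → E) → ℝ} (hS : ContDiff ℝ 1 S)
    (t s c : ℝ) {D : Λ → ℝ}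
    (hD : ∀ (ω : Λ → sphere (0 : E) 1) (k : Λ) (v v' : sphere (0 : E) 1),
      (t * S (sphereTDFlow hG T s c (fun m => ((update ω k v) m : E))) -
          sphereTDFlowLogJac hG T s c (fun m => ((update ω k v) m : E))) -
        (t * S (sphereTDFlow hG T s c (fun m => ((update ω k v') m : E))) -
          sphereTDFlowLogJac hG T s c (fun m => ((update ω k v') m : E))) ≤ D k) :
    1 - ((∑ k, D k ^ 2) / 8 + Real.sqrt ((∑ k, D k ^ 2) / 8)) ≤
      ∫ ω, (∫ ω', min 1 (Real.exp
          ((t * S (sphereTDFlow hG T s c (fun m => ((ω : Λ → sphere (0 : E) 1) m : E))) -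
              sphereTDFlowLogJac hG T s c (fun m => (ω m : E))) -
            (t * S (sphereTDFlow hG T s c (fun m => ((ω' : Λ → sphere (0 : E) 1) m : E))) -
              sphereTDFlowLogJac hG T s c (fun m => (ω' m : E)))))
          ∂Measure.pi (fun _ : Λ => uniformSphere (volume : Measure E)))
        ∂(Measure.pi (fun _ : Λ => uniformSphere (volume : Measure E))).tilted (fun ω =>
          -(t * S (sphereTDFlow hG T s c (fun m => (ω m : E))) -
              sphereTDFlowLogJac hG T s c (fun m => (ω m : E)))) := by
  refine le_trans ?_ (exp_neg_le_meanAccept_of_bddDiff hG hG3 hS t s c hD (T := T))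
  have h := Real.add_one_le_exp (-((∑ k, D k ^ 2) / 8 + Real.sqrt ((∑ k, D k ^ 2) / 8)))
  linarith

end Summit.Ventures.LatticeQCDFlow.Exactness

end
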